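import Summits.AtomisticToContinuum.Crystallization.Theses.PalmUnimodularRigidity
import Summits.AtomisticToContinuum.Crystallization.Theorems.MinimiserShells.Negative.LoadBearing
import Summits.AtomisticToContinuum.Crystallization.Theorems.MinimiserShells.Negative.Rootedness
import Literature.Probability.Process.PointStationaryLaw
import Literature.MathematicalPhysics.StatisticalMechanics.RootEnergy
import Literature.MathematicalPhysics.StatisticalMechanics.MuGSC
import Summits.AtomisticToContinuum.Crystallization.Theorems.PalmUnimodularRigidityMinimiserShellsEnergyFloorB
import Summits.AtomisticToContinuum.Crystallization.Theorems.PalmUnimodularRigidityMinimiserShellsPalmDensity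

/-!
# Palm zero-density lemma — stub `stub_palmZeroDensity` (S6′), line `equilibrium-in-law-surgery`,
# crux `MinimiserShells` (stmt-AtomisticToContinuum-9225)

Under a point-stationary `δ`-hard-core probability law `P` on rooted configurations of `ℝ³`, "badly
shelled atoms have ZERO DENSITY about the root a.s." transfers to "the ROOT is a.s. well shelled"
(`stub_palmZeroDensity`; the measurable set `B` reading off `GoodShell` on hard-core configurations,
stub S5 of the line, is a HYPOTHESIS).  No rate and no volume growth are assumed, so one transport
(as in the landed S6, `…PalmDensity`) does not suffice: one transport PER SCALE `3^k`, and AM–GM.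
* transport `g_R(μ, y) = 1_{Bᶜ}(μ) 1[‖y‖ ≤ R] / trunc_δ μ (B̄(y, 2R))`, jointly measurable through
  the s-finite truncated configuration kernel `trunc δ` of `…EnergyFloorDefs` (`= μ` on hard-core
  `μ`), `measurable_transport`;
* OUT-mass `≥ 1_{Bᶜ}(μ) N_R/N_{3R}`, `N_r = μ(B̄(0,r))`, as `B̄(y,2R) ⊆ B̄(0,3R)`
  (`le_lintegral_transport`); IN-mass `≤ bad_R/N_R ≤ 1` (`θ_y μ (B̄(-y,2R)) = N_{2R} ≥ N_R`,
  `lintegral_transport_map_le`), `→ 0` a.s. along `R = 3^k` by hypothesis; its measurable version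
  is `measurable_inMass`;
* Mecke: `E[1_{Bᶜ} N_{3^k}/N_{3^{k+1}}] ≤ ε_k := E[IN_k] → 0` (dominated convergence); AM–GM with
  the telescoping product, the root (`N_1 ≥ 1`) and packing (`N_{3^K} ≤ (27(2/δ+1)³)^K`) give
  `Σ_{k<K} N_{3^k}/N_{3^{k+1}} ≥ c₀ K` (`ofReal_mul_le_sum_ratio`), so `c₀ K P(Bᶜ) ≤ Σ_{k<K} ε_k
  = o(K)` (Cesàro) and `P(Bᶜ) = 0` (`measure_compl_eq_zero_of_cesaro`).
-/

noncomputable section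

open MeasureTheory ProbabilityTheory
open scoped ENNReal BigOperators

namespace Summit.AtomisticToContinuum.Crystallization.Theorems.PalmUnimodularRigidityMinimiserShells.PalmZeroDensity

open Literature.Probability.Process (IsPointStationaryLaw IsRootedHardCore count_restrict_singleton_ne_zero_iff
  map_sub_count_restrict)
open Literature.MathematicalPhysics.StatisticalMechanics (lennardJones IsMuGSC UniformlyDiscrete)
open Summit.AtomisticToContinuum.Crystallization.Theses.PalmUnimodularRigidity (MinimiserShells UnimodularEnergyLowerBound)
open Summit.AtomisticToContinuum.Crystallization.Theorems.MinimiserShells.Negative.LoadBearing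
  (eStar meanRootEnergy GoodShell minimiserShells_iff)
open Summit.AtomisticToContinuum.Crystallization.Theorems.MinimiserShells.Negative.Rootedness
  (E3 countable_of_separated)
open Summit.AtomisticToContinuum.Crystallization.Theorems.PalmUnimodularRigidityMinimiserShells.EnergyFloor
  (trunc truncKernel trunc_of_mem mem_hcClass_of_hc measurable_trunc_apply ncard_inter_closedBall_le)
open Summit.AtomisticToContinuum.Crystallization.Theorems.PalmUnimodularRigidityMinimiserShells.PalmDensity
  (count_eq_ncard)

/-- **AM–GM, sum form**: `K ≠ 0` nonnegative reals with product `≥ m ^ K`, `m ≥ 0`, sum to `≥ K m`. -/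
theorem card_mul_le_sum_of_pow_le_prod {K : ℕ} (hK : K ≠ 0) {z : ℕ → ℝ} (hz : ∀ k, 0 ≤ z k)
    {m : ℝ} (hm : 0 ≤ m) (h : m ^ K ≤ ∏ k ∈ Finset.range K, z k) :
    (K : ℝ) * m ≤ ∑ k ∈ Finset.range K, z k := by
  have hw := Real.geom_mean_le_arith_mean_weighted (Finset.range K) (fun _ => (K : ℝ)⁻¹) z
    (fun _ _ => inv_nonneg.2 (Nat.cast_nonneg K))
    (by rw [Finset.sum_const, Finset.card_range, nsmul_eq_mul, mul_inv_cancel₀ (Nat.cast_ne_zero.2 hK)])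
    (fun k _ => hz k)
  rw [Real.finsetProd_rpow _ _ (fun k _ => hz k), ← Finset.mul_sum] at hw
  have h2 : m ≤ (∏ k ∈ Finset.range K, z k) ^ ((K : ℝ)⁻¹) :=
    calc m = (m ^ K) ^ ((K : ℝ)⁻¹) := (Real.pow_rpow_inv_natCast hm hK).symm
      _ ≤ _ := Real.rpow_le_rpow (pow_nonneg hm K) h (inv_nonneg.2 (Nat.cast_nonneg K))
  calc (K : ℝ) * m ≤ K * ((K : ℝ)⁻¹ * ∑ k ∈ Finset.range K, z k) :=
        mul_le_mul_of_nonneg_left (h2.trans hw) (Nat.cast_nonneg K)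
    _ = ∑ k ∈ Finset.range K, z k := by rw [← mul_assoc, mul_inv_cancel₀ (Nat.cast_ne_zero.2 hK), one_mul]

/-- Telescoping product of successive ratios: `∏_{k<K} n k / n (k+1) = n 0 / n K`. -/
theorem prod_range_div_succ {n : ℕ → ℝ} (hn : ∀ k, n k ≠ 0) :
    ∀ K : ℕ, ∏ k ∈ Finset.range K, n k / n (k + 1) = n 0 / n K
  | 0 => by rw [Finset.prod_range_zero, div_self (hn 0)]
  | K + 1 => by
      rw [Finset.prod_range_succ, prod_range_div_succ hn K, div_mul_div_comm, mul_comm (n 0) (n K),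
        mul_div_mul_left _ _ (hn K)]

/-- Packing at scale `3^K`, `K ≠ 0`: `(2·3^K/δ + 1)³ ≤ (27 (2/δ+1)³)^K`. -/
theorem packing_pow_le {δ : ℝ} (hδ : 0 < δ) {K : ℕ} (hK : K ≠ 0) :
    (2 * (3 : ℝ) ^ K / δ + 1) ^ 3 ≤ (27 * (2 / δ + 1) ^ 3) ^ K := by
  have h1 : (1 : ℝ) ≤ 3 ^ K := one_le_pow₀ (by norm_num)
  have hA : 2 * (3 : ℝ) ^ K / δ + 1 ≤ 3 ^ K * (2 / δ + 1) := by
    have : (3 : ℝ) ^ K * (2 / δ + 1) = 2 * 3 ^ K / δ + 3 ^ K := by ring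
    linarith
  calc (2 * (3 : ℝ) ^ K / δ + 1) ^ 3 ≤ (3 ^ K * (2 / δ + 1)) ^ 3 := by gcongr
    _ = 27 ^ K * (2 / δ + 1) ^ 3 := by
        rw [mul_pow, ← pow_mul, mul_comm K 3, pow_mul]; norm_num
    _ ≤ 27 ^ K * ((2 / δ + 1) ^ 3) ^ K := mul_le_mul_of_nonneg_left
        (le_self_pow₀ (one_le_pow₀ (le_add_of_nonneg_left (by positivity))) hK) (by positivity)
    _ = (27 * (2 / δ + 1) ^ 3) ^ K := by rw [mul_pow]

/-- The density of badly-shelled atoms in a (finite!) ball about the root is at most `1`. -/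
theorem ncard_bad_div_le_one {S : Set E3} (hud : UniformlyDiscrete S) (R : ℝ) :
    ({y ∈ S | dist y 0 ≤ R ∧ ¬ GoodShell ((Measure.count : Measure E3).restrict
        ((fun z => z - y) '' S))}.ncard : ℝ) / ({y ∈ S | dist y 0 ≤ R}.ncard : ℝ) ≤ 1 := by
  have hDfin : {y ∈ S | dist y 0 ≤ R}.Finite :=
    (hud.finite_inter_closedBall 0 R).subset fun y hy => ⟨hy.1, Metric.mem_closedBall.2 hy.2⟩
  have hsub : {y ∈ S | dist y 0 ≤ R ∧ ¬ GoodShell ((Measure.count : Measure E3).restrict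
      ((fun z => z - y) '' S))} ⊆ {y ∈ S | dist y 0 ≤ R} := fun y hy => ⟨hy.1, hy.2.1⟩
  refine div_le_one_of_le₀ ?_ (Nat.cast_nonneg _)
  exact_mod_cast Set.ncard_le_ncard hsub hDfin

/-- **AM–GM over scales.** For a rooted `δ`-hard-core `μ`: `Σ_{k<K} μ(B̄(0,3^k))/μ(B̄(0,3^{k+1}))
≥ c₀ K`, `c₀ = (27 (2/δ+1)³)⁻¹` (the product of the ratios telescopes to `N_1/N_{3^K} ≥ c₀^K` by the
root and packing; then AM–GM). -/
theorem ofReal_mul_le_sum_ratio {δ : ℝ} (hδ : 0 < δ) {μ : Measure E3} (hμ : IsRootedHardCore δ μ)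
    (K : ℕ) :
    ENNReal.ofReal ((27 * (2 / δ + 1) ^ 3)⁻¹ * K) ≤
      ∑ k ∈ Finset.range K, μ (Metric.closedBall (0 : E3) (3 ^ k)) *
        (μ (Metric.closedBall (0 : E3) (3 ^ (k + 1))))⁻¹ := by
  obtain ⟨S, h0, hsep, rfl⟩ := hμ
  have hfin : ∀ k : ℕ, (Metric.closedBall (0 : E3) (3 ^ k) ∩ S).Finite := fun k => by
    rw [Set.inter_comm]
    exact UniformlyDiscrete.finite_inter_closedBall ⟨δ, hδ, hsep⟩ 0 _
  set N : ℕ → ℕ := fun k => (Metric.closedBall (0 : E3) (3 ^ k) ∩ S).ncard with hN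
  have hμN : ∀ k : ℕ, (Measure.count : Measure E3).restrict S (Metric.closedBall (0 : E3) (3 ^ k)) =
      ((N k : ℕ) : ℝ≥0∞) := fun k => by
    rw [Measure.restrict_apply measurableSet_closedBall, count_eq_ncard (hfin k)]
  have hNpos : ∀ k, 0 < N k := fun k =>
    (Set.ncard_pos (hfin k)).2 ⟨0, Metric.mem_closedBall_self (by positivity), h0⟩
  have hNle : ∀ k : ℕ, (N k : ℝ) ≤ (2 * 3 ^ k / δ + 1) ^ 3 := fun k => by
    have h := ncard_inter_closedBall_le hδ hsep 0 (r := (3 : ℝ) ^ k) (by positivity) (hfin k).toFinset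
      (by rw [Set.Finite.coe_toFinset, Set.inter_comm])
    rwa [← Set.ncard_eq_toFinset_card _ (hfin k)] at h
  have hterm : ∀ k : ℕ, (Measure.count : Measure E3).restrict S (Metric.closedBall (0 : E3) (3 ^ k)) *
      ((Measure.count : Measure E3).restrict S (Metric.closedBall (0 : E3) (3 ^ (k + 1))))⁻¹ =
      ENNReal.ofReal ((N k : ℝ) / (N (k + 1) : ℝ)) := fun k => by
    rw [hμN, hμN, ENNReal.ofReal_div_of_pos (Nat.cast_pos.2 (hNpos _)), ENNReal.ofReal_natCast,
      ENNReal.ofReal_natCast, div_eq_mul_inv]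
  rw [Finset.sum_congr rfl fun k _ => hterm k, ← ENNReal.ofReal_sum_of_nonneg fun k _ => by positivity]
  refine ENNReal.ofReal_le_ofReal ?_
  rcases Nat.eq_zero_or_pos K with rfl | hK
  · simp
  have key := card_mul_le_sum_of_pow_le_prod hK.ne' (z := fun k => (N k : ℝ) / N (k + 1))
    (fun k => by positivity) (m := (27 * (2 / δ + 1) ^ 3)⁻¹) (by positivity) ?_
  · rw [mul_comm]
    exact key
  · rw [prod_range_div_succ (n := fun k => (N k : ℝ)) (fun k => (Nat.cast_pos.2 (hNpos k)).ne') K,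
      inv_pow]
    calc ((27 * (2 / δ + 1) ^ 3) ^ K)⁻¹ ≤ ((N K : ℝ))⁻¹ :=
          inv_anti₀ (Nat.cast_pos.2 (hNpos K)) ((hNle K).trans (packing_pow_le hδ hK.ne'))
      _ = 1 / N K := inv_eq_one_div _
      _ ≤ N 0 / N K := div_le_div_of_nonneg_right (Nat.one_le_cast.2 (hNpos 0)) (Nat.cast_nonneg _)

/-- The transport `g_R(μ, y) = 1_{Bᶜ}(μ) · 1[‖y‖ ≤ R] · (trunc_δ μ (B̄(y, 2R)))⁻¹` is jointly
measurable (`B` measurable; the last factor through the s-finite truncated kernel). -/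
theorem measurable_transport {B : Set (Measure E3)} (hB : MeasurableSet B) (δ R : ℝ) :
    Measurable (Function.uncurry fun (μ : Measure E3) (y : E3) =>
      Bᶜ.indicator (fun _ => (1 : ℝ≥0∞)) μ *
        (Metric.closedBall (0 : E3) R).indicator (fun _ => (1 : ℝ≥0∞)) y *
        (trunc δ μ (Metric.closedBall y (2 * R)))⁻¹) := by
  have hs : MeasurableSet {q : E3 × E3 | dist q.2 q.1 ≤ 2 * R} :=
    measurableSet_le (measurable_snd.dist measurable_fst) measurable_const
  have h3 : Measurable fun p : Measure E3 × E3 => trunc δ p.1 (Metric.closedBall p.2 (2 * R)) :=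
    measurable_trunc_apply hs
  exact (((measurable_const.indicator hB.compl).comp measurable_fst).mul
    ((measurable_const.indicator measurableSet_closedBall).comp measurable_snd)).mul h3.inv

/-- Re-rooting the truncated configuration, `(μ, y) ↦ θ_y (trunc_δ μ) = (trunc_δ μ).map (· - y)`, is
jointly measurable into the Giry σ-algebra. -/
theorem measurable_map_sub_trunc (δ : ℝ) :
    Measurable fun p : Measure E3 × E3 => Measure.map (fun z => z - p.2) (trunc δ p.1) := by
  refine Measure.measurable_of_measurable_coe _ fun s hs => ?_
  have h := measurable_trunc_apply (δ := δ) (α := E3) ((measurable_snd.sub measurable_fst) hs)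
  convert h using 1
  funext p
  exact Measure.map_apply (measurable_sub_const p.2) hs

/-- **Measurable IN-mass**: the mass received at the root at scale `3^k`, written through the
truncated configuration (a measurable function of `μ`; on hard-core `μ` it IS the IN-mass). -/
theorem measurable_inMass {B : Set (Measure E3)} (hB : MeasurableSet B) (δ : ℝ) (k : ℕ) :
    Measurable fun μ : Measure E3 => ∫⁻ y,
      Bᶜ.indicator (fun _ => (1 : ℝ≥0∞)) (Measure.map (fun z => z - y) (trunc δ μ)) *
        (Metric.closedBall (0 : E3) (3 ^ k)).indicator (fun _ => (1 : ℝ≥0∞)) (-y) *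
        (trunc δ (Measure.map (fun z => z - y) (trunc δ μ)) (Metric.closedBall (-y) (2 * 3 ^ k)))⁻¹
      ∂(trunc δ μ) :=
  Measurable.lintegral_kernel_prod_right (κ := truncKernel δ)
    ((measurable_transport hB δ (3 ^ k)).comp ((measurable_map_sub_trunc δ).prodMk measurable_snd.neg))

/-- **OUT-mass.** A rooted hard-core configuration outside `B` sends out mass `≥ N_{3^k}/N_{3^{k+1}}`,
`N_r = μ(B̄(0,r))`: each atom `y`, `‖y‖ ≤ 3^k`, receives `1/μ(B̄(y, 2·3^k)) ≥ 1/N_{3^{k+1}}`. -/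
theorem le_lintegral_transport (B : Set (Measure E3)) {δ : ℝ} (hδ : 0 < δ) {μ : Measure E3}
    (hμ : IsRootedHardCore δ μ) (k : ℕ) :
    Bᶜ.indicator (fun _ => (1 : ℝ≥0∞)) μ *
        (μ (Metric.closedBall (0 : E3) (3 ^ k)) * (μ (Metric.closedBall (0 : E3) (3 ^ (k + 1))))⁻¹) ≤
      ∫⁻ y, Bᶜ.indicator (fun _ => (1 : ℝ≥0∞)) μ *
        (Metric.closedBall (0 : E3) (3 ^ k)).indicator (fun _ => (1 : ℝ≥0∞)) y *
        (trunc δ μ (Metric.closedBall y (2 * 3 ^ k)))⁻¹ ∂μ := by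
  rw [trunc_of_mem (mem_hcClass_of_hc hδ hμ)]
  have hK : MeasurableSet (Metric.closedBall (0 : E3) (3 ^ k)) := measurableSet_closedBall
  rw [← one_mul (μ (Metric.closedBall (0 : E3) (3 ^ k))), ← lintegral_indicator_const hK,
    ← lintegral_mul_const _ (measurable_const.indicator hK),
    ← lintegral_const_mul _ ((measurable_const.indicator hK).mul_const _)]
  refine lintegral_mono fun y => ?_
  rw [← mul_assoc]
  by_cases hy : y ∈ Metric.closedBall (0 : E3) (3 ^ k)
  · refine mul_le_mul' le_rfl (ENNReal.inv_le_inv.2 (measure_mono fun z hz => ?_))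
    rw [Metric.mem_closedBall] at hz hy ⊢
    have h3 : (3 : ℝ) ^ (k + 1) = 3 * 3 ^ k := pow_succ' 3 k
    linarith [dist_triangle z y (0 : E3)]
  · simp [Set.indicator_of_notMem hy]

/-- **IN-mass bound.** For a rooted hard-core `count|S` the mass received at the root at scale
`R ≥ 0` is `≤ #{y ∈ S ∩ B̄_R(0) | y badly shelled} / #(S ∩ B̄_R(0))`: the atom `y ∈ S` sends
`1[θ_y μ ∉ B] 1[‖y‖ ≤ R] / θ_y μ(B̄(-y, 2R))`, `θ_y μ = count|(S - y)` is rooted hard-core (so `B`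
reads off `GoodShell`, `trunc` does nothing) and `θ_y μ (B̄(-y, 2R)) = #(S ∩ B̄_{2R}(0)) ≥ #D ≥ 1`. -/
theorem lintegral_transport_map_le {B : Set (Measure E3)}
    (hB : ∀ δ : ℝ, 0 < δ → ∀ μ : Measure E3, IsRootedHardCore δ μ → (μ ∈ B ↔ GoodShell μ))
    {δ R : ℝ} (hδ : 0 < δ) (hR : 0 ≤ R) {S : Set E3}
    (hcore : IsRootedHardCore δ ((Measure.count : Measure E3).restrict S)) :
    ∫⁻ y, Bᶜ.indicator (fun _ => (1 : ℝ≥0∞))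
          (Measure.map (fun z => z - y) ((Measure.count : Measure E3).restrict S)) *
        (Metric.closedBall (0 : E3) R).indicator (fun _ => (1 : ℝ≥0∞)) (-y) *
        (trunc δ (Measure.map (fun z => z - y) ((Measure.count : Measure E3).restrict S))
          (Metric.closedBall (-y) (2 * R)))⁻¹ ∂((Measure.count : Measure E3).restrict S) ≤
      ENNReal.ofReal (({y ∈ S | dist y 0 ≤ R ∧ ¬ GoodShell ((Measure.count : Measure E3).restrict
          ((fun z => z - y) '' S))}.ncard : ℝ) / ({y ∈ S | dist y 0 ≤ R}.ncard : ℝ)) := by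
  obtain ⟨S', h0, hsep, hSS'⟩ := id hcore
  obtain rfl : S = S' := Set.ext fun y => by
    rw [← count_restrict_singleton_ne_zero_iff S y, ← count_restrict_singleton_ne_zero_iff S' y, hSS']
  have hud : UniformlyDiscrete S := ⟨δ, hδ, hsep⟩
  set A : Set E3 := {y ∈ S | dist y 0 ≤ R ∧ ¬ GoodShell ((Measure.count : Measure E3).restrict
      ((fun z => z - y) '' S))} with hA
  set D : Set E3 := {y ∈ S | dist y 0 ≤ R} with hD
  have hDfin : D.Finite :=
    (hud.finite_inter_closedBall 0 R).subset fun y hy => ⟨hy.1, Metric.mem_closedBall.2 hy.2⟩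
  have hAfin : A.Finite := hDfin.subset fun y hy => ⟨hy.1, hy.2.1⟩
  have hDpos : 0 < D.ncard := (Set.ncard_pos hDfin).2 ⟨0, h0, by rw [dist_self]; exact hR⟩
  have hcountD : (Measure.count : Measure E3).restrict S (Metric.closedBall (0 : E3) R) =
      ((D.ncard : ℕ) : ℝ≥0∞) := by
    rw [Measure.restrict_apply measurableSet_closedBall, show Metric.closedBall (0 : E3) R ∩ S = D from
      Set.ext fun z => ⟨fun h => ⟨h.2, h.1⟩, fun h => ⟨h.2, h.1⟩⟩, count_eq_ncard hDfin]
  -- pointwise bound at every atom `y ∈ S`, then integrate over the atoms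
  calc _ ≤ ∫⁻ y, A.indicator (fun _ => (((D.ncard : ℕ) : ℝ≥0∞))⁻¹) y
        ∂((Measure.count : Measure E3).restrict S) := by
        refine lintegral_mono_ae ((ae_restrict_iff' (countable_of_separated hδ hsep).measurableSet).2
          (Filter.Eventually.of_forall fun y hy => ?_))
        set ν : Measure E3 := Measure.map (fun z => z - y) ((Measure.count : Measure E3).restrict S)
          with hνdef
        have hν : ν = (Measure.count : Measure E3).restrict ((fun z => z - y) '' S) :=
          map_sub_count_restrict S y
        have hνcore : IsRootedHardCore δ ν :=
          hcore.map_sub ((count_restrict_singleton_ne_zero_iff S y).2 hy)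
        have hνB : ν ∈ B ↔ GoodShell ν := hB δ hδ ν hνcore
        have hνball : ((D.ncard : ℕ) : ℝ≥0∞) ≤ ν (Metric.closedBall (-y) (2 * R)) := by
          rw [← hcountD, hνdef, Measure.map_apply (measurable_sub_const y) measurableSet_closedBall]
          refine measure_mono fun z hz => ?_
          rw [Set.mem_preimage, Metric.mem_closedBall, dist_eq_norm, sub_neg_eq_add, sub_add_cancel]
          rw [Metric.mem_closedBall, dist_zero_right] at hz
          linarith
        rw [trunc_of_mem (mem_hcClass_of_hc hδ hνcore)]
        by_cases hyA : y ∈ A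
        · rw [Set.indicator_of_mem hyA]
          calc Bᶜ.indicator (fun _ => (1 : ℝ≥0∞)) ν *
                (Metric.closedBall (0 : E3) R).indicator (fun _ => (1 : ℝ≥0∞)) (-y) *
                (ν (Metric.closedBall (-y) (2 * R)))⁻¹
              ≤ 1 * 1 * (ν (Metric.closedBall (-y) (2 * R)))⁻¹ :=
                mul_le_mul' (mul_le_mul' (Set.indicator_le_self _ _ _) (Set.indicator_le_self _ _ _))
                  le_rfl
            _ ≤ (((D.ncard : ℕ) : ℝ≥0∞))⁻¹ := by
                rw [one_mul, one_mul]
                exact ENNReal.inv_le_inv.2 hνball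
        · rw [Set.indicator_of_notMem hyA]
          refine le_of_eq ?_
          by_cases hd : dist y 0 ≤ R
          · have hgood : GoodShell ν := by
              rw [hν]
              by_contra hg
              exact hyA ⟨hy, hd, hg⟩
            rw [Set.indicator_of_notMem (fun h => h (hνB.2 hgood) : ν ∉ Bᶜ), zero_mul, zero_mul]
          · have hyK : -y ∉ Metric.closedBall (0 : E3) R := fun h => hd (by
              rwa [Metric.mem_closedBall, dist_zero_right, norm_neg, ← dist_zero_right] at h)
            rw [Set.indicator_of_notMem hyK, mul_zero, zero_mul]
    _ = (((D.ncard : ℕ) : ℝ≥0∞))⁻¹ * (Measure.count : Measure E3) A := by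
        rw [lintegral_indicator_const hAfin.measurableSet, Measure.restrict_apply hAfin.measurableSet,
          Set.inter_eq_left.2 (fun y hy => hy.1)]
    _ = ENNReal.ofReal ((A.ncard : ℝ) / (D.ncard : ℝ)) := by
        rw [count_eq_ncard hAfin, ENNReal.ofReal_div_of_pos (Nat.cast_pos.2 hDpos),
          ENNReal.ofReal_natCast, ENNReal.ofReal_natCast, ENNReal.div_eq_inv_mul]

/-- **Cesàro–dominated-convergence step.** `B` measurable, `a k, I k` measurable with
`E[1_{Bᶜ} a_k] ≤ E[I_k]`, `I_k ≤ 1` and `I_k → 0` a.s., and a.s. `Σ_{k<K} a_k ≥ c₀ K` for all `K`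
(`c₀ > 0`) imply `P(Bᶜ) = 0`: `c₀ K P(Bᶜ) ≤ Σ_{k<K} E[I_k] = o(K)` (dominated convergence, Cesàro). -/
theorem measure_compl_eq_zero_of_cesaro (P : Measure (Measure E3)) [IsProbabilityMeasure P]
    {B : Set (Measure E3)} (hBm : MeasurableSet B) {c₀ : ℝ} (hc₀ : 0 < c₀)
    {a I : ℕ → Measure E3 → ℝ≥0∞} (ham : ∀ k, Measurable (a k)) (hIm : ∀ k, Measurable (I k))
    (hle : ∀ k, ∫⁻ μ, Bᶜ.indicator (fun _ => (1 : ℝ≥0∞)) μ * a k μ ∂P ≤ ∫⁻ μ, I k μ ∂P)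
    (hI1 : ∀ k, ∀ᵐ μ ∂P, I k μ ≤ 1)
    (hI0 : ∀ᵐ μ ∂P, Filter.Tendsto (fun k => I k μ) Filter.atTop (nhds 0))
    (ha : ∀ᵐ μ ∂P, ∀ K : ℕ, ENNReal.ofReal (c₀ * K) ≤ ∑ k ∈ Finset.range K, a k μ) :
    P Bᶜ = 0 := by
  set ε : ℕ → ℝ≥0∞ := fun k => ∫⁻ μ, I k μ ∂P with hε
  have h11 : ∫⁻ _, (1 : ℝ≥0∞) ∂P = 1 := by rw [lintegral_const, measure_univ, mul_one]
  have hεtop : ∀ k, ε k ≠ ∞ := fun k =>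
    ne_top_of_le_ne_top ENNReal.one_ne_top ((lintegral_mono_ae (hI1 k)).trans h11.le)
  -- dominated convergence `ε k → 0`, in real numbers, then Cesàro
  have hε0 : Filter.Tendsto (fun k => (ε k).toReal) Filter.atTop (nhds 0) := by
    have h := tendsto_lintegral_of_dominated_convergence (μ := P) (fun _ => (1 : ℝ≥0∞)) hIm
      (fun k => hI1 k) (by rw [h11]; exact ENNReal.one_ne_top) hI0
    simp only [lintegral_zero] at h
    have h' := (ENNReal.tendsto_toReal ENNReal.zero_ne_top).comp h
    rwa [ENNReal.toReal_zero] at h'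
  -- the inequality at every `K`
  have hK : ∀ K : ℕ, ENNReal.ofReal (c₀ * K) * P Bᶜ ≤ ∑ k ∈ Finset.range K, ε k := by
    intro K
    have hmeas : ∀ k ∈ Finset.range K,
        AEMeasurable (fun μ => Bᶜ.indicator (fun _ => (1 : ℝ≥0∞)) μ * a k μ) P :=
      fun k _ => ((measurable_const.indicator hBm.compl).mul (ham k)).aemeasurable
    calc ENNReal.ofReal (c₀ * K) * P Bᶜ
        = ∫⁻ μ, Bᶜ.indicator (fun _ => (1 : ℝ≥0∞)) μ * ENNReal.ofReal (c₀ * K) ∂P := by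
          rw [lintegral_mul_const _ (measurable_const.indicator hBm.compl),
            lintegral_indicator_const hBm.compl, one_mul, mul_comm]
      _ ≤ ∫⁻ μ, ∑ k ∈ Finset.range K, Bᶜ.indicator (fun _ => (1 : ℝ≥0∞)) μ * a k μ ∂P := by
          refine lintegral_mono_ae (ha.mono fun μ hμ => ?_)
          rw [← Finset.mul_sum]
          exact mul_le_mul' le_rfl (hμ K)
      _ = ∑ k ∈ Finset.range K, ∫⁻ μ, Bᶜ.indicator (fun _ => (1 : ℝ≥0∞)) μ * a k μ ∂P :=
          lintegral_finsetSum' _ hmeas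
      _ ≤ ∑ k ∈ Finset.range K, ε k := Finset.sum_le_sum fun k _ => hle k
  -- pass to real numbers
  have hreal : ∀ K : ℕ, 0 < K →
      (P Bᶜ).toReal ≤ c₀⁻¹ * ((K : ℝ)⁻¹ * ∑ k ∈ Finset.range K, (ε k).toReal) := by
    intro K hKpos
    have h2 := ENNReal.toReal_mono (ENNReal.sum_ne_top.2 fun k _ => hεtop k) (hK K)
    have hcK : 0 < c₀ * K := mul_pos hc₀ (Nat.cast_pos.2 hKpos)
    rw [ENNReal.toReal_mul, ENNReal.toReal_ofReal hcK.le, ENNReal.toReal_sum (fun k _ => hεtop k)] at h2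
    calc (P Bᶜ).toReal = (c₀ * K)⁻¹ * (c₀ * K * (P Bᶜ).toReal) := by
          rw [← mul_assoc, inv_mul_cancel₀ hcK.ne', one_mul]
      _ ≤ (c₀ * K)⁻¹ * ∑ k ∈ Finset.range K, (ε k).toReal :=
          mul_le_mul_of_nonneg_left h2 (inv_nonneg.2 hcK.le)
      _ = c₀⁻¹ * ((K : ℝ)⁻¹ * ∑ k ∈ Finset.range K, (ε k).toReal) := by rw [mul_inv, mul_assoc]
  have hlim : Filter.Tendsto (fun K : ℕ => c₀⁻¹ * ((K : ℝ)⁻¹ * ∑ k ∈ Finset.range K, (ε k).toReal))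
      Filter.atTop (nhds 0) := by
    simpa using hε0.cesaro.const_mul c₀⁻¹
  have hp : (P Bᶜ).toReal = 0 := le_antisymm
    (ge_of_tendsto hlim (Filter.eventually_atTop.2 ⟨1, fun K hK1 => hreal K hK1⟩)) ENNReal.toReal_nonneg
  rw [ENNReal.toReal_eq_zero_iff] at hp
  exact hp.resolve_right (measure_ne_top P _)

/-- **Palm zero-density lemma** (stub `stub_palmZeroDensity`, S6′ of line `equilibrium-in-law-surgery`
of crux `MinimiserShells`).  Given a measurable set `B` of configurations agreeing with `GoodShell` on
rooted hard-core counting measures: under a point-stationary `δ`-hard-core probability law a.s.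
carried by configurations `count|S` whose badly-shelled atoms have zero density about the root
(`#bad(S ∩ B̄_R(0)) / #(S ∩ B̄_R(0)) → 0`), the root shell is a.s. good.  Multi-scale mass transport,
Mecke, AM–GM over the scales `3^k`, Cesàro (module docstring): `P(Bᶜ) = 0`. -/
theorem stub_palmZeroDensity :
    (∃ B : Set (Measure (EuclideanSpace ℝ (Fin 3))), MeasurableSet B ∧
      ∀ δ : ℝ, 0 < δ → ∀ μ : Measure (EuclideanSpace ℝ (Fin 3)), IsRootedHardCore δ μ → (μ ∈ B ↔ GoodShell μ)) →
    ∀ δ : ℝ, 0 < δ → ∀ P : Measure (Measure (EuclideanSpace ℝ (Fin 3))),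
      IsProbabilityMeasure P → (∀ᵐ μ ∂P, IsRootedHardCore δ μ) → IsPointStationaryLaw P →
      (∀ᵐ μ ∂P, ∃ S : Set (EuclideanSpace ℝ (Fin 3)),
          μ = (Measure.count : Measure (EuclideanSpace ℝ (Fin 3))).restrict S ∧
          Filter.Tendsto (fun R : ℝ =>
            ({y ∈ S | dist y 0 ≤ R ∧ ¬ GoodShell ((Measure.count : Measure (EuclideanSpace ℝ (Fin 3))).restrict
                ((fun z => z - y) '' S))}.ncard : ℝ) / ({y ∈ S | dist y 0 ≤ R}.ncard : ℝ))
            Filter.atTop (nhds 0)) →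
      ∀ᵐ μ ∂P, GoodShell μ := by
  rintro ⟨B, hBm, hB⟩ δ hδ P hP hcore hstat hdens
  have hc₀ : (0 : ℝ) < (27 * (2 / δ + 1) ^ 3)⁻¹ := by positivity
  have hPB : P Bᶜ = 0 := by
    refine measure_compl_eq_zero_of_cesaro P hBm hc₀
      (a := fun k μ => μ (Metric.closedBall (0 : E3) (3 ^ k)) *
        (μ (Metric.closedBall (0 : E3) (3 ^ (k + 1))))⁻¹)
      (fun k => (Measure.measurable_coe measurableSet_closedBall).mul
        (Measure.measurable_coe measurableSet_closedBall).inv)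
      (fun k => measurable_inMass hBm δ k) (fun k => ?_) (fun k => ?_) ?_ ?_
    · -- Mecke: `E[1_{Bᶜ} a_k] ≤ E[OUT_k] = E[IN_k]`
      refine (lintegral_mono_ae (hcore.mono fun μ hμ => le_lintegral_transport B hδ hμ k)).trans ?_
      refine (hstat _ (measurable_transport hBm δ (3 ^ k))).trans_le (lintegral_congr_ae ?_).le
      refine hcore.mono fun μ hμ => ?_
      beta_reduce
      rw [trunc_of_mem (mem_hcClass_of_hc hδ hμ)]
    · -- `IN_k ≤ 1` a.s.
      filter_upwards [hcore] with μ hμ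
      obtain ⟨S, -, hsep, rfl⟩ := id hμ
      beta_reduce
      rw [trunc_of_mem (mem_hcClass_of_hc hδ hμ)]
      refine (lintegral_transport_map_le hB hδ (R := 3 ^ k) (by positivity) hμ).trans ?_
      exact ENNReal.ofReal_le_one.2 (ncard_bad_div_le_one ⟨δ, hδ, hsep⟩ _)
    · -- `IN_k → 0` a.s.
      filter_upwards [hcore, hdens] with μ hμ hS
      obtain ⟨S, rfl, hq⟩ := hS
      have hlim := ENNReal.tendsto_ofReal (hq.comp (tendsto_pow_atTop_atTop_of_one_lt
        (by norm_num : (1 : ℝ) < 3)))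
      rw [ENNReal.ofReal_zero] at hlim
      refine tendsto_of_tendsto_of_tendsto_of_le_of_le tendsto_const_nhds hlim (fun _ => zero_le)
        fun k => ?_
      beta_reduce
      rw [trunc_of_mem (mem_hcClass_of_hc hδ hμ)]
      exact lintegral_transport_map_le hB hδ (R := 3 ^ k) (by positivity) hμ
    · -- AM–GM over scales
      filter_upwards [hcore] with μ hμ K
      exact ofReal_mul_le_sum_ratio hδ hμ K
  have hmem : ∀ᵐ μ ∂P, μ ∈ B := by rw [ae_iff]; exact hPB
  filter_upwards [hcore, hmem] with μ hμ hμB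
  exact (hB δ hδ μ hμ).1 hμB

end Summit.AtomisticToContinuum.Crystallization.Theorems.PalmUnimodularRigidityMinimiserShells.PalmZeroDensity

end
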